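import Literature.NumberTheory.LFunctions.FordRows
import Literature.NumberTheory.LFunctions.FordRowsRun1
import Literature.NumberTheory.LFunctions.FordRowsRun2
import Literature.NumberTheory.LFunctions.FordRowsRun3
import Literature.NumberTheory.LFunctions.FordRowsRun4
import Literature.NumberTheory.LFunctions.FordRowsRun5
import Literature.NumberTheory.LFunctions.FordRowsRun6
import Literature.NumberTheory.LFunctions.FordRowsRun7
import Literature.NumberTheory.LFunctions.FordRowsRun8
import Literature.NumberTheory.LFunctions.FordRowsRun9
import Literature.NumberTheory.LFunctions.FordRowsRun10
import Literature.NumberTheory.LFunctions.FordExpSumSmallLambda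
import Literature.NumberTheory.LFunctions.FordZetaBoundMain13
import HarnessLib

/-!
# Ford's Theorem 2 (constant `13`) for `1 ≤ λ ≤ 87`, and Theorem 1 reduced to `λ > 87`

Topic `Literature/NumberTheory/LFunctions`. Pure proof file. K. Ford, Proc. LMS 85 (2002),
Theorem 2: `S(N,t) ≤ 9.463 N^{1-1/(133.66λ²)}`, `λ = log t/log N`. The tree has it for
`1 ≤ λ ≤ 8` (`FordVK.expSum_bound_small_lambda`, van der Corput) and now, with constant `13`, for
`8 ≤ λ ≤ 87` from the `79` kernel-certified rows `k = 9, …, 87` of Table 6.1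
(`FordVK.row9`–`FordVK.row87`, `FordVK.row_const`; target constant `12` for `k ≤ 84`, `13` for
`85 ≤ k ≤ 87`, where the tree's prime windows `(x, 1.15x]` cost more than Rosser–Schoenfeld's):

* `FordVK.rows_all` — every `9 ≤ k ≤ 87` has an accepted certificate with target constant `≤ 13`;
* `FordVK.expSum_bound_mid_lambda` — for `1 ≤ N ≤ t ≤ N^{87}`, `0 < u ≤ 1`, `N < R ≤ 2N`:
  `‖∑_{N<n≤R}(n+u)^{-it}‖ ≤ 13 · N^{1-(log N)²/(133.66 log² t)}`;
* `zeta_bound_ford_of_exp_sum_bound13_lambda_gt_87` — Ford's Theorem 1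
  (`Literature.NumberTheory.LFunctions.zeta_bound_ford`) now follows from Theorem 2 (constant `13`)
  restricted to `t ≥ N^{87}` — exactly the range `λ ≥ 87` of Ford's §5 (Lemmas 5.2–5.3 via
  Theorems 3–4), still to be formalised.

## References

* K. Ford, Proc. London Math. Soc. (3) 85 (2002), 565–633; arXiv:1910.08209: Theorem 2, Lemma 6.8,
  Table 6.1. [Ford2002]
-/

noncomputable section

open Finset

namespace Literature.NumberTheory.LFunctions

namespace FordVK

/-- **All rows `9 ≤ k ≤ 87` are certified** (target constant `12` for `k ≤ 84`, `13` for
`85 ≤ k ≤ 87`). [cite: Ford2002, Lemma 6.8 (Table 6.1)] -/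
theorem rows_all (k : ℕ) (hk1 : 9 ≤ k) (hk2 : k ≤ 87) :
    ∃ C n₀ V : ℕ, ∃ l : List Step, C ≤ 13 ∧ rowCheck C k n₀ V l = true := by
  interval_cases k
  exacts [
    ⟨12, _, _, _, by norm_num, row9⟩, ⟨12, _, _, _, by norm_num, row10⟩, ⟨12, _, _, _, by norm_num, row11⟩, ⟨12, _, _, _, by norm_num, row12⟩,
    ⟨12, _, _, _, by norm_num, row13⟩, ⟨12, _, _, _, by norm_num, row14⟩, ⟨12, _, _, _, by norm_num, row15⟩, ⟨12, _, _, _, by norm_num, row16⟩,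
    ⟨12, _, _, _, by norm_num, row17⟩, ⟨12, _, _, _, by norm_num, row18⟩, ⟨12, _, _, _, by norm_num, row19⟩, ⟨12, _, _, _, by norm_num, row20⟩,
    ⟨12, _, _, _, by norm_num, row21⟩, ⟨12, _, _, _, by norm_num, row22⟩, ⟨12, _, _, _, by norm_num, row23⟩, ⟨12, _, _, _, by norm_num, row24⟩,
    ⟨12, _, _, _, by norm_num, row25⟩, ⟨12, _, _, _, by norm_num, row26⟩, ⟨12, _, _, _, by norm_num, row27⟩, ⟨12, _, _, _, by norm_num, row28⟩,
    ⟨12, _, _, _, by norm_num, row29⟩, ⟨12, _, _, _, by norm_num, row30⟩, ⟨12, _, _, _, by norm_num, row31⟩, ⟨12, _, _, _, by norm_num, row32⟩,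
    ⟨12, _, _, _, by norm_num, row33⟩, ⟨12, _, _, _, by norm_num, row34⟩, ⟨12, _, _, _, by norm_num, row35⟩, ⟨12, _, _, _, by norm_num, row36⟩,
    ⟨12, _, _, _, by norm_num, row37⟩, ⟨12, _, _, _, by norm_num, row38⟩, ⟨12, _, _, _, by norm_num, row39⟩, ⟨12, _, _, _, by norm_num, row40⟩,
    ⟨12, _, _, _, by norm_num, row41⟩, ⟨12, _, _, _, by norm_num, row42⟩, ⟨12, _, _, _, by norm_num, row43⟩, ⟨12, _, _, _, by norm_num, row44⟩,
    ⟨12, _, _, _, by norm_num, row45⟩, ⟨12, _, _, _, by norm_num, row46⟩, ⟨12, _, _, _, by norm_num, row47⟩, ⟨12, _, _, _, by norm_num, row48⟩,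
    ⟨12, _, _, _, by norm_num, row49⟩, ⟨12, _, _, _, by norm_num, row50⟩, ⟨12, _, _, _, by norm_num, row51⟩, ⟨12, _, _, _, by norm_num, row52⟩,
    ⟨12, _, _, _, by norm_num, row53⟩, ⟨12, _, _, _, by norm_num, row54⟩, ⟨12, _, _, _, by norm_num, row55⟩, ⟨12, _, _, _, by norm_num, row56⟩,
    ⟨12, _, _, _, by norm_num, row57⟩, ⟨12, _, _, _, by norm_num, row58⟩, ⟨12, _, _, _, by norm_num, row59⟩, ⟨12, _, _, _, by norm_num, row60⟩,
    ⟨12, _, _, _, by norm_num, row61⟩, ⟨12, _, _, _, by norm_num, row62⟩, ⟨12, _, _, _, by norm_num, row63⟩, ⟨12, _, _, _, by norm_num, row64⟩,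
    ⟨12, _, _, _, by norm_num, row65⟩, ⟨12, _, _, _, by norm_num, row66⟩, ⟨12, _, _, _, by norm_num, row67⟩, ⟨12, _, _, _, by norm_num, row68⟩,
    ⟨12, _, _, _, by norm_num, row69⟩, ⟨12, _, _, _, by norm_num, row70⟩, ⟨12, _, _, _, by norm_num, row71⟩, ⟨12, _, _, _, by norm_num, row72⟩,
    ⟨12, _, _, _, by norm_num, row73⟩, ⟨12, _, _, _, by norm_num, row74⟩, ⟨12, _, _, _, by norm_num, row75⟩, ⟨12, _, _, _, by norm_num, row76⟩,
    ⟨12, _, _, _, by norm_num, row77⟩, ⟨12, _, _, _, by norm_num, row78⟩, ⟨12, _, _, _, by norm_num, row79⟩, ⟨12, _, _, _, by norm_num, row80⟩,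
    ⟨12, _, _, _, by norm_num, row81⟩, ⟨12, _, _, _, by norm_num, row82⟩, ⟨12, _, _, _, by norm_num, row83⟩, ⟨12, _, _, _, by norm_num, row84⟩,
    ⟨13, _, _, _, le_rfl, row85⟩, ⟨13, _, _, _, le_rfl, row86⟩, ⟨13, _, _, _, le_rfl, row87⟩]

/-- **Ford's Theorem 2 with constant `13` for `1 ≤ λ ≤ 87`**: for `1 ≤ N ≤ t ≤ N^{87}`,
`0 < u ≤ 1`, `N < R ≤ 2N`, `‖∑_{N<n≤R}(n+u)^{-it}‖ ≤ 13 · N^{1-(log N)²/(133.66 log² t)}`.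
[cite: Ford2002, Theorem 2 (with Lemma 6.8, Table 6.1; constant 9.463 there)] -/
theorem expSum_bound_mid_lambda (N R : ℕ) (t u : ℝ) (hN : 1 ≤ N) (hNt : (N : ℝ) ≤ t)
    (ht : t ≤ (N : ℝ) ^ 87) (hu0 : 0 < u) (hu1 : u ≤ 1) (hNR : N < R) (hR : R ≤ 2 * N) :
    ‖∑ n ∈ Finset.Ioc N R, ((n : ℂ) + u) ^ (-(t * Complex.I))‖
      ≤ 13 * (N : ℝ) ^ (1 - Real.log N ^ 2 / (133.66 * Real.log t ^ 2)) := by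
  classical
  rcases le_or_gt t ((N : ℝ) ^ 8) with h8 | h8
  · refine (expSum_bound_small_lambda N R t u hN hNt h8 hu0 hu1 hNR hR).trans ?_
    exact mul_le_mul_of_nonneg_right (by norm_num) (by positivity)
  · -- the least `k` with `t ≤ N^k`
    have hex : ∃ k : ℕ, t ≤ (N : ℝ) ^ k := ⟨87, ht⟩
    set k := Nat.find hex with hk
    have hk_spec : t ≤ (N : ℝ) ^ k := Nat.find_spec hex
    have hk87 : k ≤ 87 := Nat.find_min' hex ht
    have hk9 : 9 ≤ k := by
      by_contra hlt
      push Not at hlt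
      have hN1 : (1 : ℝ) ≤ N := by exact_mod_cast hN
      have : (N : ℝ) ^ k ≤ (N : ℝ) ^ 8 := pow_le_pow_right₀ hN1 (by omega)
      linarith
    have hlow : (N : ℝ) ^ (k - 1) ≤ t := by
      by_contra hlt
      push Not at hlt
      have := Nat.find_min hex (show k - 1 < k by omega)
      exact this hlt.le
    obtain ⟨C, n₀, V, l, hC13, hcert⟩ := rows_all k hk9 hk87
    refine (row_const hcert hN hNR hR hu0 hu1 hlow hk_spec).trans ?_
    exact mul_le_mul_of_nonneg_right (by exact_mod_cast hC13) (by positivity)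

end FordVK

/-- **Ford's Theorem 1 reduced to Theorem 2 on `λ ≥ 87`.** With the rows `k ≤ 87` certified,
`zeta_bound_ford` follows from the bound `S(N,t) ≤ 13 N^{1-1/(133.66λ²)}` for `t ≥ N^{87}` alone
(Ford §5: Lemmas 5.2–5.3 via Theorems 3–4). [cite: Ford2002, Theorem 1 (proof, §7) with Theorem 2] -/
theorem zeta_bound_ford_of_exp_sum_bound13_lambda_gt_87
    (hT2 : ∀ (N R : ℕ) (t u : ℝ), 1 ≤ N → (N : ℝ) ^ 87 ≤ t → 0 < u → u ≤ 1 → N < R → R ≤ 2 * N →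
      ‖∑ n ∈ Finset.Ioc N R, ((n : ℂ) + u) ^ (-(t * Complex.I))‖
        ≤ 13 * (N : ℝ) ^ (1 - Real.log N ^ 2 / (133.66 * Real.log t ^ 2))) :
    zeta_bound_ford :=
  zeta_bound_ford_of_exp_sum_bound13_large_lambda fun N R t u hN hNt hu0 hu1 hNR hR => by
    rcases le_or_gt t ((N : ℝ) ^ 87) with h87 | h87
    · have hN1 : (1 : ℝ) ≤ N := by exact_mod_cast hN
      have hNt' : (N : ℝ) ≤ t := le_trans (by
        calc (N : ℝ) = (N : ℝ) ^ 1 := (pow_one _).symm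
          _ ≤ (N : ℝ) ^ 8 := pow_le_pow_right₀ hN1 (by norm_num)) hNt
      exact FordVK.expSum_bound_mid_lambda N R t u hN hNt' h87 hu0 hu1 hNR hR
    · exact hT2 N R t u hN h87.le hu0 hu1 hNR hR

end Literature.NumberTheory.LFunctions
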